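import Summits.BirchSwinnertonDyer.BirchSwinnertonDyer.Theorems.GenusKolyvaginAtTwoEquivariantKolyvaginExactAtTwoTwinDualityRat
import Summits.BirchSwinnertonDyer.BirchSwinnertonDyer.Theorems.GenusKolyvaginAtTwoEquivariantKolyvaginExactAtTwoLocalTorsionCount
import Summits.BirchSwinnertonDyer.BirchSwinnertonDyer.Theorems.GenusKolyvaginAtTwoVisiblePairAtTwoDefs
import Literature.NumberTheory.EllipticCurves.CasselsTateSelmerLocalValue
import Literature.NumberTheory.EllipticCurves.LocalTorsionInvariants
import HarnessLib

/-!
# Route `GenusKolyvaginAtTwo`, crux `KolyvaginExactAtTwo` (22137) → Q3-inner: injectivity of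
# `ι_* : H¹(ℚ_q, A[m]) → H¹(ℚ_q, A[m²])` at the Kolyvagin primes of the `ℚ`-pair, by COUNTING invariants

Seat `bsd-line-gk2-p2` g12 (cell `bsd-f1-sign2`). THEOREMS ONLY (no definition, no named fact, no `sorry`).

McCallum's value formula (Prop. 4.7) needs, at the places `λ_q` of the "old" primes `q ∣ m'` of the depth,
that the local term of the Cassels–Tate pairing vanishes; the tree's form of this
(`CasselsTateSelmerLocalValue.ctLevelPairing_pullback_eq_localTerm`) asks for `loc_q t = 0` AND the injectivity
of `ι_* : H¹(K_q, E[m]) → H¹(K_q, E[m²])`, which over `K_λ` (Kolyvagin prime of level `m²` OVER `K`) comes from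
`E[m²] ⊆ E(K_λ)` (`map_inclKD_restrictField_injective_of_forall_smul_eq`). Over `ℚ_q` at `p = 2` this fails
(`E[2^M] ⊄ E(ℚ_q)`: only the `Frob_q = τ`-fixed line is rational), but injectivity still holds: the kernel of
`ι_*` is the cokernel of `[m] : E[m²]^{Γ} → E[m]^{Γ}`, and at a Gross–Kolyvagin prime of a `Δ < 0` curve of
index `≥ 2L` (`m = 2^L`) the two invariant groups have orders `m²` and `m`
(`LocalTorsionCount.natCard_ker_zsmul_adicCompletion_two_pow_eq`, its twin
`FrobeniusCriterion.natCard_ker_nsmul_quadraticTwist_adicCompletion_two_pow_eq`), so `[m]` is onto by counting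
(its kernel on the invariants is `ι(E[m]^{Γ})`, of order `m`).

* §1 `map_inclKD_restrictField_injective_of_natCard` — generic: `#E[m²]^{Γ_F} = m · #E[m]^{Γ_F}` (finite)
  ⟹ `ι_*` injective on `H¹(F, ·)` (any `K`-field `F`);
* §2 `natCard_invariants_adicCompletion_eq` — `#E[n]^{Γ_{ℚ_v}} = #E(ℚ_v)[n]` (the tree's
  `invariantsTorsionEquivKerZSMul`), and the instance: `map_inclKD_restrictField_injective_kolPrime` (member `E`),
  `map_inclKD_restrictField_injective_kolPrime_twin` (member `E^{(d_K)}`) at every `kolPrime W K (L + L) q`.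

BSD is not proved by any of this.

References: [McCallumLMS1991] §4 Prop. 4.7, §5 Lemma 5.3; [SerreGaloisCohomology1997] I §2.2;
[GrossLMS1991] §3 (3.2)–(3.3); [MilneADT2006] I Lemma 3.3.
-/

set_option linter.dupNamespace false -- tree convention: `Summit.BirchSwinnertonDyer.BirchSwinnertonDyer.Theorems` (summit = sub-problem)
set_option autoImplicit false

noncomputable section

open scoped Classical

universe u

namespace Summit.BirchSwinnertonDyer.BirchSwinnertonDyer.Theorems.GenusExact.VisiblePairAtTwo

open WeierstrassCurve NumberField IsDedekindDomain Field Function Rat.HeightOneSpectrum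
open Literature.NumberTheory.EllipticCurves Literature.NumberTheory.GaloisRepresentations
open Summit.BirchSwinnertonDyer.BirchSwinnertonDyer.Theorems.GenusExact.ReductionCyclic
open Summit.BirchSwinnertonDyer.BirchSwinnertonDyer.Theorems.GenusExact.FrobeniusCriterion

/-! ## §1. Injectivity of `ι_*` from a count of invariants -/

section Generic

variable {K : Type u} [Field K] [CharZero K] (A : WeierstrassCurve K) (m : ℕ) [NeZero m]
  (F : Type u) [Field F] [Algebra K F]

/-- **`[m] : E[m²]^{Γ_F} → E[m]^{Γ_F}` is onto when `#E[m²]^{Γ_F} = m · #E[m]^{Γ_F}`** (finite groups): its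
kernel on the invariants is `ι(E[m]^{Γ_F})` (exactness of `0 → E[m] → E[m²] → E[m] → 0`, `ι` injective and
equivariant), of order `#E[m]^{Γ_F}`, so its image has order `#E[m²]^{Γ_F} / #E[m]^{Γ_F} = m`… — in general
`#image · #E[m]^{Γ_F} ≥ #E[m²]^{Γ_F}`, whence the image is everything. [cite: SerreGaloisCohomology1997, I §2.2] -/
theorem exists_invariant_mulK_eq_of_natCard
    (h₁ : 0 < Nat.card (GaloisRep.restrictField F (A.torsionGaloisModule (m : ℤ))).invariants)
    (h₂ : Nat.card (GaloisRep.restrictField F (A.torsionGaloisModule ((m * m : ℕ) : ℤ))).invariants =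
      Nat.card (GaloisRep.restrictField F (A.torsionGaloisModule (m : ℤ))).invariants *
        Nat.card (GaloisRep.restrictField F (A.torsionGaloisModule (m : ℤ))).invariants)
    (v : geomTorsion A (m : ℤ))
    (hv : v ∈ (GaloisRep.restrictField F (A.torsionGaloisModule (m : ℤ))).invariants) :
    ∃ w ∈ (GaloisRep.restrictField F (A.torsionGaloisModule ((m * m : ℕ) : ℤ))).invariants,
      mulK A m m w = v := by
  set I₁ := (GaloisRep.restrictField F (A.torsionGaloisModule (m : ℤ))).invariants with hI₁
  set I₂ := (GaloisRep.restrictField F (A.torsionGaloisModule ((m * m : ℕ) : ℤ))).invariants with hI₂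
  haveI : Finite I₁ := Nat.finite_of_card_ne_zero h₁.ne'
  haveI : Finite I₂ := Nat.finite_of_card_ne_zero (by rw [h₂]; exact (Nat.mul_pos h₁ h₁).ne')
  have hS := torsion_isSES_nat A m
  -- equivariance of `[m]` and `ι`
  have hmul : ∀ (σ : absoluteGaloisGroup K) (w : geomTorsion A ((m * m : ℕ) : ℤ)),
      mulK A m m (σ • w) = σ • mulK A m m w := fun σ w ↦
    DFunLike.congr_fun ((mulK A m m).isIntertwining' σ) w
  have hincl : ∀ (σ : absoluteGaloisGroup K) (u : geomTorsion A (m : ℤ)),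
      inclKD A m m (σ • u) = σ • inclKD A m m u := fun σ u ↦
    DFunLike.congr_fun ((inclKD A m m).isIntertwining' σ) u
  -- the restriction `f : I₂ → I₁` of `[m]`
  have hmem : ∀ w : I₂, mulK A m m (w : geomTorsion A ((m * m : ℕ) : ℤ)) ∈ I₁ := fun w ↦ by
    rw [hI₁, ContinuousRep.mem_invariants]
    intro g
    have hw := (ContinuousRep.mem_invariants _ _).mp w.2 g
    rw [restrictField_torsionGaloisModule_apply] at hw ⊢
    rw [← hmul, hw]
  let f : I₂ →+ I₁ := AddMonoidHom.mk' (fun w ↦ ⟨mulK A m m w, hmem w⟩) fun w₁ w₂ ↦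
    Subtype.ext (by simp only [Submodule.coe_add, map_add])
  -- `ker f ↪ I₁`: a `Γ_F`-invariant `w` with `[m] w = 0` is `ι u` with `u` invariant
  have hker : ∀ w : f.ker, ∃ u : I₁, inclKD A m m (u : geomTorsion A (m : ℤ)) =
      ((w : I₂) : geomTorsion A ((m * m : ℕ) : ℤ)) := by
    intro w
    have hw0 : mulK A m m ((w : I₂) : geomTorsion A ((m * m : ℕ) : ℤ)) = 0 :=
      congrArg Subtype.val ((AddMonoidHom.mem_ker).mp w.2)
    obtain ⟨u, hu⟩ := hS.exact_mid _ hw0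
    refine ⟨⟨u, ?_⟩, hu⟩
    rw [hI₁, ContinuousRep.mem_invariants]
    intro g
    rw [restrictField_torsionGaloisModule_apply]
    apply hS.injective
    have hw := (ContinuousRep.mem_invariants _ _).mp (w : I₂).2 g
    rw [restrictField_torsionGaloisModule_apply] at hw
    change inclKD A m m (absGaloisRestrict K F g • u) = inclKD A m m u
    rw [hincl]
    change absGaloisRestrict K F g • (DiscreteGaloisModule.homOfIntertwining (inclKD A m m)).hom u = _
    rw [hu, hw]
    exact hu.symm
  choose uof huof using hker
  have huinj : Injective uof := by
    intro w₁ w₂ h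
    have h' := congrArg (fun u : I₁ ↦ inclKD A m m (u : geomTorsion A (m : ℤ))) h
    simp only [huof] at h'
    exact Subtype.ext (Subtype.ext h')
  have hkcard : Nat.card f.ker ≤ Nat.card I₁ := Nat.card_le_card_of_injective uof huinj
  -- counting: `#I₂ = #ker · #range`, hence `#range = #I₁`
  have hq : Nat.card (I₂ ⧸ f.ker) = Nat.card f.range :=
    Nat.card_congr (QuotientAddGroup.quotientKerEquivRange f).toEquiv
  have hprod : Nat.card I₂ = Nat.card f.ker * Nat.card f.range := by
    have h := AddSubgroup.card_eq_card_quotient_mul_card_addSubgroup f.ker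
    rw [hq] at h
    rw [h, mul_comm]
  have hrange_le : Nat.card f.range ≤ Nat.card I₁ := AddSubgroup.card_le_card_addGroup f.range
  have hrange : Nat.card f.range = Nat.card I₁ := by
    refine le_antisymm hrange_le ?_
    have h := hprod
    rw [h₂] at h
    nlinarith [hkcard, Nat.card_pos (α := I₁)]
  have htop : f.range = ⊤ := AddSubgroup.eq_top_of_card_eq f.range hrange
  obtain ⟨w, hw⟩ : (⟨v, hv⟩ : I₁) ∈ f.range := by rw [htop]; exact AddSubgroup.mem_top _
  exact ⟨w, w.2, congrArg Subtype.val hw⟩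

/-- **`ι_* : H¹(F, E[m]) → H¹(F, E[m²])` is injective when `[m] : E[m²]^{Γ_F} → E[m]^{Γ_F}` is onto**
(the connecting map `δ₀ : E[m]^{Γ_F} → H¹(F, E[m])` of `0 → E[m] → E[m²] → E[m] → 0` then vanishes; tree
`IsSES.δ₀_eq_zero_iff`, `IsSES.exists_δ₀_eq_of_map_one_eq_zero`). [cite: SerreGaloisCohomology1997, I §2.2] -/
theorem map_inclKD_restrictField_injective_of_forall_exists
    (hsurj : ∀ v : geomTorsion A (m : ℤ),
      v ∈ (GaloisRep.restrictField F (A.torsionGaloisModule (m : ℤ))).invariants →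
      ∃ w ∈ (GaloisRep.restrictField F (A.torsionGaloisModule ((m * m : ℕ) : ℤ))).invariants,
        mulK A m m w = v) :
    Injective (galoisCohomology.map ((inclKD A m m).restrictField F) 1) := by
  rw [injective_iff_map_eq_zero]
  intro x hx
  have hS := (torsion_isSES_nat A m).restrictField F
  obtain ⟨v, hv⟩ := hS.exists_δ₀_eq_of_map_one_eq_zero x hx
  have hv0 : hS.δ₀ v = 0 := by
    rw [hS.δ₀_eq_zero_iff]
    obtain ⟨w, hw, hwv⟩ := hsurj v.1 v.2
    exact ⟨w, hw, by rw [DiscreteGaloisModule.resFieldHom_apply]; exact hwv⟩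
  rw [← hv, hv0]
  rfl

/-- **`ι_*` is injective on `H¹(F, ·)` when `#E[m²]^{Γ_F} = (#E[m]^{Γ_F})²` (finite, non-empty).**
[cite: SerreGaloisCohomology1997, I §2.2] -/
theorem map_inclKD_restrictField_injective_of_natCard
    (h₁ : 0 < Nat.card (GaloisRep.restrictField F (A.torsionGaloisModule (m : ℤ))).invariants)
    (h₂ : Nat.card (GaloisRep.restrictField F (A.torsionGaloisModule ((m * m : ℕ) : ℤ))).invariants =
      Nat.card (GaloisRep.restrictField F (A.torsionGaloisModule (m : ℤ))).invariants *
        Nat.card (GaloisRep.restrictField F (A.torsionGaloisModule (m : ℤ))).invariants) :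
    Injective (galoisCohomology.map ((inclKD A m m).restrictField F) 1) :=
  map_inclKD_restrictField_injective_of_forall_exists A m F
    (fun v hv ↦ exists_invariant_mulK_eq_of_natCard A m F h₁ h₂ v hv)

end Generic

/-! ## §2. The counts at the Kolyvagin primes of the `ℚ`-pair, and the instance

Over `ℚ` a completion `ℚ_v` carries two `ℚ`-algebra structures in the tree (`Place.instAlgebraCompletion`, through
which the Cassels–Tate files restrict, and Mathlib's `DivisionRing.toRatAlgebra`); the statements below PIN the
former with `letI`, so that they feed `CasselsTateSelmerLocalValue.ctLevelPairing_pullback_eq_localTerm` verbatim. -/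

section Instance

variable {W : WeierstrassCurve ℚ} [W.IsElliptic] [W.IsGloballyMinimal] {K : Type} [Field K] [NumberField K]

/-- **`#E[2^k]^{Γ_{ℚ_q}} = 2^k`** at a Kolyvagin prime `q` of the instance of level `2^N` (`k ≤ N`), `Δ(E) < 0`:
the tree's `invariantsTorsionEquivKerZSMul` (`H⁰(ℚ_q, E[n]) = E(ℚ_q)[n]`) and this lineage's
`natCard_ker_zsmul_adicCompletion_two_pow_eq` (`#E(ℚ_q)[2^k] = 2^k`, McCallum Lemma 5.3 (i) over `ℚ_q`).
[cite: McCallumLMS1991, §5 Lemma 5.3] [cite: MilneADT2006, I Lemma 3.3] -/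
theorem natCard_invariants_two_pow_eq_of_kolPrime (hΔ : W.Δ < 0) {N q : ℕ} (hq : kolPrime W K N q)
    {k : ℕ} (hk : k ≤ N) :
    letI : Algebra ℚ (Place.Completion (Sum.inr (primesEquiv.symm ⟨q, hq.1⟩) : Place ℚ)) :=
      Place.instAlgebraCompletion _
    Nat.card (GaloisRep.restrictField
        (Place.Completion (Sum.inr (primesEquiv.symm ⟨q, hq.1⟩) : Place ℚ))
        (W.torsionGaloisModule ((2 ^ k : ℕ) : ℤ))).invariants = 2 ^ k := by
  obtain ⟨hqp, hq2, -, hgood, -, hF2, hidx, -⟩ := hq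
  haveI : Fact q.Prime := ⟨hqp⟩
  have hv : (q : 𝓞 ℚ) ∈ (primesEquiv.symm ⟨q, hqp⟩ : HeightOneSpectrum (𝓞 ℚ)).asIdeal :=
    natCast_mem_primesEquiv_symm hqp
  have hn : ((2 ^ k : ℕ) : ℤ) ≠ 0 := by positivity
  haveI : CharZero (Place.Completion (Sum.inr (primesEquiv.symm ⟨q, hqp⟩) : Place ℚ)) :=
    charZero_placeCompletion _
  letI : Algebra ℚ (Place.Completion (Sum.inr (primesEquiv.symm ⟨q, hqp⟩) : Place ℚ)) :=
    Place.instAlgebraCompletion _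
  rw [Nat.card_congr (@WeierstrassCurve.invariantsTorsionEquivKerZSMul ℚ _ _ W _
    (Place.Completion (Sum.inr (primesEquiv.symm ⟨q, hqp⟩) : Place ℚ)) _ (Place.instAlgebraCompletion _) _ _
    hn).toEquiv]
  exact natCard_ker_zsmul_adicCompletion_two_pow_eq W hΔ hq2 hgood hF2 hv (hk.trans hidx)

/-- **`#E[2^L · 2^L]^{Γ_{ℚ_q}} = 2^L · 2^L`** at a Kolyvagin prime of level `2^{L+L}` (the previous count at
`k = L + L`, level written as a product for the Cassels–Tate machinery at `(m, m²) = (2^L, 2^L · 2^L)`).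
[cite: McCallumLMS1991, §5 Lemma 5.3] -/
theorem natCard_invariants_mul_eq_of_kolPrime (hΔ : W.Δ < 0) {L q : ℕ} (hq : kolPrime W K (L + L) q) :
    letI : Algebra ℚ (Place.Completion (Sum.inr (primesEquiv.symm ⟨q, hq.1⟩) : Place ℚ)) :=
      Place.instAlgebraCompletion _
    Nat.card (GaloisRep.restrictField
        (Place.Completion (Sum.inr (primesEquiv.symm ⟨q, hq.1⟩) : Place ℚ))
        (W.torsionGaloisModule ((2 ^ L * 2 ^ L : ℕ) : ℤ))).invariants = 2 ^ L * 2 ^ L := by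
  obtain ⟨hqp, hq2, -, hgood, -, hF2, hidx, -⟩ := hq
  haveI : Fact q.Prime := ⟨hqp⟩
  have hv : (q : 𝓞 ℚ) ∈ (primesEquiv.symm ⟨q, hqp⟩ : HeightOneSpectrum (𝓞 ℚ)).asIdeal :=
    natCast_mem_primesEquiv_symm hqp
  have hn : ((2 ^ L * 2 ^ L : ℕ) : ℤ) ≠ 0 := by positivity
  haveI : CharZero (Place.Completion (Sum.inr (primesEquiv.symm ⟨q, hqp⟩) : Place ℚ)) :=
    charZero_placeCompletion _
  letI : Algebra ℚ (Place.Completion (Sum.inr (primesEquiv.symm ⟨q, hqp⟩) : Place ℚ)) :=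
    Place.instAlgebraCompletion _
  rw [Nat.card_congr (@WeierstrassCurve.invariantsTorsionEquivKerZSMul ℚ _ _ W _
    (Place.Completion (Sum.inr (primesEquiv.symm ⟨q, hqp⟩) : Place ℚ)) _ (Place.instAlgebraCompletion _) _ _
    hn).toEquiv, ← pow_add]
  exact natCard_ker_zsmul_adicCompletion_two_pow_eq W hΔ hq2 hgood hF2 hv hidx

/-- **`ι_* : H¹(ℚ_q, E[2^L]) → H¹(ℚ_q, E[2^L · 2^L])` is injective at every Kolyvagin prime `q` of level
`2^{L+L}` of the instance** (`Δ(E) < 0`): the counts `2^L · 2^L` and `2^L` of §2 fed into §1 — the `ℚ_q`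
substitute for McCallum's `E[p^{M+M'}] ⊆ E(K_λ)` at the primes of `n` in Prop. 4.7.
[cite: McCallumLMS1991, §4 Prop. 4.7] [cite: SerreGaloisCohomology1997, I §2.2] -/
theorem map_inclKD_restrictField_injective_of_kolPrime (hΔ : W.Δ < 0) {L q : ℕ}
    (hq : kolPrime W K (L + L) q) :
    letI : Algebra ℚ (Place.Completion (Sum.inr (primesEquiv.symm ⟨q, hq.1⟩) : Place ℚ)) :=
      Place.instAlgebraCompletion _
    Injective (galoisCohomology.map ((inclKD W (2 ^ L) (2 ^ L)).restrictField
      (Place.Completion (Sum.inr (primesEquiv.symm ⟨q, hq.1⟩) : Place ℚ))) 1) := by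
  have h₁ := natCard_invariants_two_pow_eq_of_kolPrime hΔ hq (Nat.le_add_right L L)
  have h₂ := natCard_invariants_mul_eq_of_kolPrime hΔ hq
  letI : Algebra ℚ (Place.Completion (Sum.inr (primesEquiv.symm ⟨q, hq.1⟩) : Place ℚ)) :=
    Place.instAlgebraCompletion _
  haveI : NeZero (2 ^ L) := ⟨pow_ne_zero L two_ne_zero⟩
  refine map_inclKD_restrictField_injective_of_natCard W (2 ^ L) _ ?_ ?_
  · rw [h₁]; positivity
  · rw [h₁, h₂]

/-- **`#E^{(d_K)}[2^k]^{Γ_{ℚ_q}} = 2^k` for the twin** at a Kolyvagin prime `q` of the instance of level `2^N`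
(`k ≤ N`): gk2-p3's `natCard_ker_nsmul_quadraticTwist_adicCompletion_two_pow_eq` (`#E^{(d_K)}(ℚ_q)[2^k] = 2^k`,
McCallum Lemma 5.3 (i), `−` part, over `ℚ_q`) read on the invariants. [cite: McCallumLMS1991, §5 Lemma 5.3]
[cite: MilneADT2006, I Lemma 3.3] -/
theorem natCard_invariants_twin_two_pow_eq_of_kolPrime [(twin W K).IsElliptic] (hK : IsImaginaryQuadratic K)
    (hodd : Odd (NumberField.discr K)) (hΔ : W.Δ < 0) {N q : ℕ} (hq : kolPrime W K N q) {k : ℕ} (hk : k ≤ N) :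
    letI : Algebra ℚ (Place.Completion (Sum.inr (primesEquiv.symm ⟨q, hq.1⟩) : Place ℚ)) :=
      Place.instAlgebraCompletion _
    Nat.card (GaloisRep.restrictField
        (Place.Completion (Sum.inr (primesEquiv.symm ⟨q, hq.1⟩) : Place ℚ))
        ((twin W K).torsionGaloisModule ((2 ^ k : ℕ) : ℤ))).invariants = 2 ^ k := by
  obtain ⟨hqp, hq2, hqd, hgood, -, hF2, hidx, -⟩ := hq
  haveI : Fact q.Prime := ⟨hqp⟩
  have hv : (q : 𝓞 ℚ) ∈ (primesEquiv.symm ⟨q, hqp⟩ : HeightOneSpectrum (𝓞 ℚ)).asIdeal :=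
    natCast_mem_primesEquiv_symm hqp
  have hn : ((2 ^ k : ℕ) : ℤ) ≠ 0 := by positivity
  haveI : CharZero (Place.Completion (Sum.inr (primesEquiv.symm ⟨q, hqp⟩) : Place ℚ)) :=
    charZero_placeCompletion _
  letI : Algebra ℚ (Place.Completion (Sum.inr (primesEquiv.symm ⟨q, hqp⟩) : Place ℚ)) :=
    Place.instAlgebraCompletion _
  rw [Nat.card_congr (@WeierstrassCurve.invariantsTorsionEquivKerZSMul ℚ _ _ (twin W K) _
    (Place.Completion (Sum.inr (primesEquiv.symm ⟨q, hqp⟩) : Place ℚ)) _ (Place.instAlgebraCompletion _) _ _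
    hn).toEquiv]
  have h := natCard_ker_nsmul_quadraticTwist_adicCompletion_two_pow_eq W hK hodd hΔ hq2 hqd hgood hF2 hv
    (hk.trans hidx) rfl
  rw [← zsmulAddGroupHom_natCast] at h
  exact h

/-- **`#E^{(d_K)}[2^L · 2^L]^{Γ_{ℚ_q}} = 2^L · 2^L` for the twin** at a Kolyvagin prime of level `2^{L+L}`.
[cite: McCallumLMS1991, §5 Lemma 5.3] -/
theorem natCard_invariants_twin_mul_eq_of_kolPrime [(twin W K).IsElliptic] (hK : IsImaginaryQuadratic K)
    (hodd : Odd (NumberField.discr K)) (hΔ : W.Δ < 0) {L q : ℕ} (hq : kolPrime W K (L + L) q) :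
    letI : Algebra ℚ (Place.Completion (Sum.inr (primesEquiv.symm ⟨q, hq.1⟩) : Place ℚ)) :=
      Place.instAlgebraCompletion _
    Nat.card (GaloisRep.restrictField
        (Place.Completion (Sum.inr (primesEquiv.symm ⟨q, hq.1⟩) : Place ℚ))
        ((twin W K).torsionGaloisModule ((2 ^ L * 2 ^ L : ℕ) : ℤ))).invariants = 2 ^ L * 2 ^ L := by
  obtain ⟨hqp, hq2, hqd, hgood, -, hF2, hidx, -⟩ := hq
  haveI : Fact q.Prime := ⟨hqp⟩
  have hv : (q : 𝓞 ℚ) ∈ (primesEquiv.symm ⟨q, hqp⟩ : HeightOneSpectrum (𝓞 ℚ)).asIdeal :=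
    natCast_mem_primesEquiv_symm hqp
  have hn : ((2 ^ L * 2 ^ L : ℕ) : ℤ) ≠ 0 := by positivity
  haveI : CharZero (Place.Completion (Sum.inr (primesEquiv.symm ⟨q, hqp⟩) : Place ℚ)) :=
    charZero_placeCompletion _
  letI : Algebra ℚ (Place.Completion (Sum.inr (primesEquiv.symm ⟨q, hqp⟩) : Place ℚ)) :=
    Place.instAlgebraCompletion _
  rw [Nat.card_congr (@WeierstrassCurve.invariantsTorsionEquivKerZSMul ℚ _ _ (twin W K) _
    (Place.Completion (Sum.inr (primesEquiv.symm ⟨q, hqp⟩) : Place ℚ)) _ (Place.instAlgebraCompletion _) _ _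
    hn).toEquiv, ← pow_add]
  have h := natCard_ker_nsmul_quadraticTwist_adicCompletion_two_pow_eq W hK hodd hΔ hq2 hqd hgood hF2 hv
    hidx rfl
  rw [← zsmulAddGroupHom_natCast] at h
  exact h

/-- **`ι_* : H¹(ℚ_q, E^{(d_K)}[2^L]) → H¹(ℚ_q, E^{(d_K)}[2^L · 2^L])` is injective for the twin** at every
Kolyvagin prime `q` of level `2^{L+L}` of the instance. [cite: McCallumLMS1991, §4 Prop. 4.7]
[cite: SerreGaloisCohomology1997, I §2.2] -/
theorem map_inclKD_restrictField_injective_twin_of_kolPrime [(twin W K).IsElliptic]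
    (hK : IsImaginaryQuadratic K) (hodd : Odd (NumberField.discr K)) (hΔ : W.Δ < 0) {L q : ℕ}
    (hq : kolPrime W K (L + L) q) :
    letI : Algebra ℚ (Place.Completion (Sum.inr (primesEquiv.symm ⟨q, hq.1⟩) : Place ℚ)) :=
      Place.instAlgebraCompletion _
    Injective (galoisCohomology.map ((inclKD (twin W K) (2 ^ L) (2 ^ L)).restrictField
      (Place.Completion (Sum.inr (primesEquiv.symm ⟨q, hq.1⟩) : Place ℚ))) 1) := by
  have h₁ := natCard_invariants_twin_two_pow_eq_of_kolPrime hK hodd hΔ hq (Nat.le_add_right L L)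
  have h₂ := natCard_invariants_twin_mul_eq_of_kolPrime hK hodd hΔ hq
  letI : Algebra ℚ (Place.Completion (Sum.inr (primesEquiv.symm ⟨q, hq.1⟩) : Place ℚ)) :=
    Place.instAlgebraCompletion _
  haveI : NeZero (2 ^ L) := ⟨pow_ne_zero L two_ne_zero⟩
  refine map_inclKD_restrictField_injective_of_natCard (twin W K) (2 ^ L) _ ?_ ?_
  · rw [h₁]; positivity
  · rw [h₁, h₂]

end Instance


end Summit.BirchSwinnertonDyer.BirchSwinnertonDyer.Theorems.GenusExact.VisiblePairAtTwo

end
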